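import Summits.QuantumFields.YangMills.Theorems.LangevinControlUVLatticeGapInUVUnitsSlabToDecay

/-!
# Box inequality ⇒ geometric decay of conditional expectations

Crux `LatticeGapInUVUnitsC` (`stmt-QuantumFields-16206`), line nested-shell-rho-mixing, stub S2
(`stub_boxToDecay`): the box analogue of `stub_slabToDecay`
(`LatticeGapInUVUnits.FemtoSlabNondegeneracy`).  For the torus Wilson measure
`μ = wilsonMeasure r.ρ β` on `(ℤ/(2S+1))⁴` write `box(x, w) = {ℓ | ∀ ν, (ℓ.1 ν - x ν).val < w}` for
the links based in the cube of side `w` with corner `x : Fin 4 → ZMod (2S+1)`, and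
`ext_M(x, w) = cylinderEvents (box(x - (M-1), w + 2(M-1)))ᶜ` for the σ-algebra of the links at least
`M` layers away from the box.  If for every box with `w + 2D ≤ 2S` and every bounded measurable `F`
reading only the box `Var F ≤ K ∫ (F - μ[F | ext_D])²` (the box inequality at margin `D ≥ 1`,
constant `K ≥ 1`), then `∫ (μ[F | ext_{jD}] - ∫ F)² ≤ (1 - 1/K)^j Var F` whenever `w + 2jD ≤ 2S`.

Proof (a port of the slab file, all four coordinates treated alike): `j = 0` is the
`L²`-contraction of conditional expectation; one step is the box inequality plus the law of total
variance; the step `j → j + 1` replaces `μ[F | ext_{jD}]` by a bounded version `G_j` reading only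
the one-layer enlargement of the level-`j` box (Markov property of the plaquette interaction,
`WilsonBlockHeatBath.exists_local_condExp_version`), applies one step to `G_j` — the margin-`D`
exterior of the enlarged box is the margin-`(j+1)D` exterior of the original one — and uses the
tower property along the nested exteriors.
-/

open scoped BigOperators
open MeasureTheory Filter Topology
open Literature.MathematicalPhysics.QuantumFieldTheory Literature.MathematicalPhysics.QuantumLattice
open Summit.QuantumFields.YangMills.Theorems.LatticeGapInUVUnits.FemtoSlabNondegeneracy

noncomputable section

namespace Summit.QuantumFields.YangMills.Theorems.LatticeGapInUVUnitsC.NestedShell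

/-! ### Box geometry on the torus `(ℤ/(2S+1))⁴` -/

/-- Boxes with pointwise equal corners and equal widths coincide. -/
theorem box_congr {S : ℕ} {a b : Fin 4 → ZMod (2 * S + 1)} {m n : ℕ} (h : ∀ ν, a ν = b ν)
    (hmn : m = n) :
    {ℓ : Edge 4 (2 * S + 1) | ∀ ν, (ℓ.1 ν - a ν).val < m} =
      {ℓ : Edge 4 (2 * S + 1) | ∀ ν, (ℓ.1 ν - b ν).val < n} := by
  obtain rfl : a = b := funext h
  subst hmn
  rfl

/-- Enlarging a box by `R` layers on every side contains it: if `b ν = x ν - R` for all `ν` and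
`m = v + 2R`, then `box(x, v) ⊆ box(b, m)` (`ZMod.val` is subadditive; no case distinction on
wrap-around is needed). -/
theorem box_subset_enlarge {S : ℕ} (x : Fin 4 → ZMod (2 * S + 1)) (v R : ℕ)
    (b : Fin 4 → ZMod (2 * S + 1)) (m : ℕ) (hb : ∀ ν, b ν = x ν - (R : ZMod (2 * S + 1)))
    (hm : m = v + 2 * R) :
    {ℓ : Edge 4 (2 * S + 1) | ∀ ν, (ℓ.1 ν - x ν).val < v} ⊆
      {ℓ : Edge 4 (2 * S + 1) | ∀ ν, (ℓ.1 ν - b ν).val < m} := by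
  intro ℓ hℓ
  simp only [Set.mem_setOf_eq] at hℓ ⊢
  intro ν
  have e : ℓ.1 ν - b ν = (ℓ.1 ν - x ν) + (R : ZMod (2 * S + 1)) := by rw [hb ν]; ring
  rw [e, hm]
  calc ((ℓ.1 ν - x ν) + (R : ZMod (2 * S + 1))).val
      ≤ (ℓ.1 ν - x ν).val + (R : ZMod (2 * S + 1)).val := ZMod.val_add_le _ _
    _ ≤ (ℓ.1 ν - x ν).val + R := by
        rw [ZMod.val_natCast]; exact Nat.add_le_add_left (Nat.mod_le _ _) _
    _ < v + 2 * R := by have := hℓ ν; omega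

/-- **Plaquette geometry**: a plaquette meeting the box `{∀ ν, (ℓ.1 ν - a ν).val < n}`
(`n + 2 < 2S+1`) has all its links in the box enlarged by one layer on every side,
`{∀ ν, (ℓ.1 ν - b ν).val < n + 2}` with `b ν = a ν - 1` (coordinatewise, its base points have
offsets `τ` or `τ + 1 (mod 2S+1)`). -/
theorem plaquette_subset_enlarge_box {S : ℕ} (a b : Fin 4 → ZMod (2 * S + 1))
    (hb : ∀ ν, b ν = a ν - 1) {n : ℕ} (hn : n + 2 < 2 * S + 1)
    (Λ : Finset (Edge 4 (2 * S + 1)))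
    (hΛ : (↑Λ : Set (Edge 4 (2 * S + 1))) = {ℓ | ∀ ν, (ℓ.1 ν - a ν).val < n})
    (y : Site 4 (2 * S + 1)) (i k : Fin 4)
    (hne : (({(y, i), (y.shift i, k), (y.shift k, i), (y, k)} : Finset (Edge 4 (2 * S + 1))) ∩
      Λ).Nonempty) :
    (↑({(y, i), (y.shift i, k), (y.shift k, i), (y, k)} : Finset (Edge 4 (2 * S + 1))) :
        Set (Edge 4 (2 * S + 1))) ⊆
      ↑Λ ∪ {ℓ : Edge 4 (2 * S + 1) | ∀ ν, (ℓ.1 ν - b ν).val < n + 2} := by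
  obtain ⟨e₀, he₀⟩ := hne
  rw [Finset.mem_inter] at he₀
  have he₀Λ : ∀ ν, (e₀.1 ν - a ν).val < n := by
    have h : e₀ ∈ (↑Λ : Set (Edge 4 (2 * S + 1))) := Finset.mem_coe.2 he₀.2
    rw [hΛ] at h
    exact h
  have hbase : ∀ e ∈ ({(y, i), (y.shift i, k), (y.shift k, i), (y, k)} :
      Finset (Edge 4 (2 * S + 1))), ∀ ν,
      (e.1 ν - a ν).val = (y ν - a ν).val ∨
        (e.1 ν - a ν).val = ((y ν - a ν).val + 1) % (2 * S + 1) := by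
    intro e he ν
    simp only [Finset.mem_insert, Finset.mem_singleton] at he
    rcases he with rfl | rfl | rfl | rfl
    · exact Or.inl rfl
    · exact val_shift_apply_sub_eq_or y i ν (a ν)
    · exact val_shift_apply_sub_eq_or y k ν (a ν)
    · exact Or.inl rfl
  have h₀ : ∀ ν, (y ν - a ν).val < n ∨ ((y ν - a ν).val + 1) % (2 * S + 1) < n := by
    intro ν
    rcases hbase e₀ he₀.1 ν with h | h
    · exact Or.inl (h ▸ he₀Λ ν)
    · exact Or.inr (h ▸ he₀Λ ν)
  intro e he
  refine Or.inr ?_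
  simp only [Set.mem_setOf_eq]
  intro ν
  have e1 : e.1 ν - b ν = (e.1 ν - a ν) + 1 := by rw [hb ν]; ring
  rw [e1, ZMod.val_add, ZMod.val_one_eq_one_mod, Nat.add_mod_mod]
  exact succ_mod_lt_of_plaquette (ZMod.val_lt _) hn (hbase e (Finset.mem_coe.1 he) ν) (h₀ ν)

section Wilson

variable {G : Type} [Group G] [TopologicalSpace G] [IsTopologicalGroup G] [CompactSpace G]
  [MeasurableSpace G] [BorelSpace G]

/-- **Markov version of the conditional expectation given a box exterior.** For a bounded
measurable `F` reading only the one-layer enlargement `box(b, n + 2)` (`b ν = a ν - 1`) of the box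
`Λ = box(a, n)` (`n + 2 < 2S+1`), `μ[F | links off Λ]` has a bounded measurable version reading only
that enlargement (locality of the plaquette interaction,
`WilsonBlockHeatBath.exists_local_condExp_version`). -/
theorem exists_box_condExp_version (r : LatticeRep G) (β : ℝ) (S : ℕ)
    (a b : Fin 4 → ZMod (2 * S + 1)) (hb : ∀ ν, b ν = a ν - 1) (n : ℕ) (hn : n + 2 < 2 * S + 1)
    {F : GaugeConfig 4 (2 * S + 1) G → ℝ} (hFm : Measurable F) {C : ℝ} (hC : ∀ U, |F U| ≤ C)
    (hFd : DependsOn F {ℓ : Edge 4 (2 * S + 1) | ∀ ν, (ℓ.1 ν - b ν).val < n + 2}) :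
    ∃ F' : GaugeConfig 4 (2 * S + 1) G → ℝ, Measurable F' ∧ (∀ U, |F' U| ≤ C) ∧
      DependsOn F' {ℓ : Edge 4 (2 * S + 1) | ∀ ν, (ℓ.1 ν - b ν).val < n + 2} ∧
      F' =ᵐ[wilsonMeasure (d := 4) (L := 2 * S + 1) r.ρ β]
        (wilsonMeasure (d := 4) (L := 2 * S + 1) r.ρ β)[F|cylinderEvents
          (X := fun _ : Edge 4 (2 * S + 1) => G)
          {ℓ : Edge 4 (2 * S + 1) | ∀ ν, (ℓ.1 ν - a ν).val < n}ᶜ] := by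
  classical
  haveI : SecondCountableTopology G :=
    (r.continuous.isClosedEmbedding r.injective).isEmbedding.secondCountableTopology
  haveI : T2Space G := (r.continuous.isClosedEmbedding r.injective).isEmbedding.t2Space
  obtain ⟨Λ, hΛc⟩ : ∃ Λ : Finset (Edge 4 (2 * S + 1)),
      (↑Λ : Set (Edge 4 (2 * S + 1))) = {ℓ | ∀ ν, (ℓ.1 ν - a ν).val < n} :=
    ⟨(Set.toFinite _).toFinset, Set.Finite.coe_toFinset _⟩
  obtain ⟨F', h1, h2, h3, h4⟩ := WilsonBlockHeatBath.exists_local_condExp_version r.ρ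
    r.continuous β Λ (T := {ℓ : Edge 4 (2 * S + 1) | ∀ ν, (ℓ.1 ν - b ν).val < n + 2})
    (fun y i k _ hne => plaquette_subset_enlarge_box a b hb hn Λ hΛc y i k hne) hFm hC
    (hFd.mono Set.subset_union_right)
  refine ⟨F', h1, h2, h3, ?_⟩
  rw [hΛc] at h4
  exact h4

/-- **The induction along nested exteriors** (levels `j ≥ 1`), with the level-`j` interior
parameters `a ν = x ν - (jD - 1)`, `n = w + 2(jD - 1)` kept abstract. -/
theorem decay_of_boxInequality (r : LatticeRep G) (β : ℝ) (S D : ℕ) (K : ℝ) (hD : 1 ≤ D)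
    (hK : 1 ≤ K)
    (hbox : ∀ (x : Fin 4 → ZMod (2 * S + 1)) (w : ℕ), w + 2 * D ≤ 2 * S →
      ∀ F : GaugeConfig 4 (2 * S + 1) G → ℝ, Measurable F → (∃ M : ℝ, ∀ U, |F U| ≤ M) →
        DependsOn F {ℓ : Edge 4 (2 * S + 1) | ∀ ν, (ℓ.1 ν - x ν).val < w} →
          ∫ U, (F U - ∫ V, F V ∂(wilsonMeasure (d := 4) (L := 2 * S + 1) r.ρ β)) ^ 2
              ∂(wilsonMeasure (d := 4) (L := 2 * S + 1) r.ρ β) ≤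
            K * ∫ U, (F U - ((wilsonMeasure (d := 4) (L := 2 * S + 1) r.ρ β)[F|cylinderEvents
              (X := fun _ : Edge 4 (2 * S + 1) => G)
              {ℓ : Edge 4 (2 * S + 1) | ∀ ν,
                (ℓ.1 ν - (x ν - ((D - 1 : ℕ) : ZMod (2 * S + 1)))).val < w + 2 * (D - 1)}ᶜ]) U) ^ 2
              ∂(wilsonMeasure (d := 4) (L := 2 * S + 1) r.ρ β))
    (x : Fin 4 → ZMod (2 * S + 1)) (w : ℕ) {F : GaugeConfig 4 (2 * S + 1) G → ℝ}
    (hFm : Measurable F) {M : ℝ} (hFb : ∀ U, |F U| ≤ M)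
    (hFd : DependsOn F {ℓ : Edge 4 (2 * S + 1) | ∀ ν, (ℓ.1 ν - x ν).val < w}) :
    ∀ j : ℕ, 1 ≤ j → ∀ (a : Fin 4 → ZMod (2 * S + 1)) (n : ℕ),
      (∀ ν, a ν = x ν - ((j * D - 1 : ℕ) : ZMod (2 * S + 1))) → n = w + 2 * (j * D - 1) →
        w + 2 * (j * D) ≤ 2 * S →
          ∫ U, (((wilsonMeasure (d := 4) (L := 2 * S + 1) r.ρ β)[F|cylinderEvents
              (X := fun _ : Edge 4 (2 * S + 1) => G)
              {ℓ : Edge 4 (2 * S + 1) | ∀ ν, (ℓ.1 ν - a ν).val < n}ᶜ]) U -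
              ∫ V, F V ∂(wilsonMeasure (d := 4) (L := 2 * S + 1) r.ρ β)) ^ 2
              ∂(wilsonMeasure (d := 4) (L := 2 * S + 1) r.ρ β) ≤
            (1 - 1 / K) ^ j *
              ∫ U, (F U - ∫ V, F V ∂(wilsonMeasure (d := 4) (L := 2 * S + 1) r.ρ β)) ^ 2
                ∂(wilsonMeasure (d := 4) (L := 2 * S + 1) r.ρ β) := by
  set μ : Measure (GaugeConfig 4 (2 * S + 1) G) := wilsonMeasure (d := 4) (L := 2 * S + 1) r.ρ β
  haveI : IsProbabilityMeasure μ :=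
    isProbabilityMeasure_wilsonMeasure (d := 4) (L := 2 * S + 1) r.ρ r.continuous β
  have hK0 : 0 < K := one_pos.trans_le hK
  have hq0 : 0 ≤ 1 - 1 / K := by
    have : 1 / K ≤ 1 := by rw [div_le_one hK0]; exact hK
    linarith
  -- ONE STEP (for an arbitrary box `box(c, v)`): box inequality + law of total variance
  have one_step : ∀ (c : Fin 4 → ZMod (2 * S + 1)) (v : ℕ), v + 2 * D ≤ 2 * S →
      ∀ H : GaugeConfig 4 (2 * S + 1) G → ℝ, Measurable H → ∀ C : ℝ, (∀ U, |H U| ≤ C) →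
        DependsOn H {ℓ : Edge 4 (2 * S + 1) | ∀ ν, (ℓ.1 ν - c ν).val < v} →
          ∫ U, ((μ[H|cylinderEvents (X := fun _ : Edge 4 (2 * S + 1) => G)
              {ℓ : Edge 4 (2 * S + 1) | ∀ ν,
                (ℓ.1 ν - (c ν - ((D - 1 : ℕ) : ZMod (2 * S + 1)))).val < v + 2 * (D - 1)}ᶜ]) U -
              ∫ V, H V ∂μ) ^ 2 ∂μ ≤
            (1 - 1 / K) * ∫ U, (H U - ∫ V, H V ∂μ) ^ 2 ∂μ := by
    intro c v hv H hHm C hHb hHd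
    have hV := hbox c v hv H hHm ⟨C, hHb⟩ hHd
    exact le_mul_of_total_variance hK hV (integral_sq_sub_condExp_add cylinderEvents_le_pi
      hHm.aestronglyMeasurable (ae_of_all μ hHb))
  intro j hj
  induction j, hj using Nat.le_induction with
  | base =>
    intro a n ha hn hw
    rw [one_mul] at ha hn hw
    rw [pow_one, box_congr ha hn]
    exact one_step x w hw F hFm M hFb hFd
  | succ j hj ih =>
    intro a n ha hn hw
    -- numerics of the margins
    have hsuccD : (j + 1) * D = j * D + D := add_one_mul j D
    have hjD' : D ≤ j * D := Nat.le_mul_of_pos_left D hj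
    have hjD : 1 ≤ j * D := hD.trans hjD'
    have hjD1 : 1 ≤ (j + 1) * D := by omega
    -- the level-`j` interior `box(a₁, n₁)` and its one-layer enlargement `box(a₂, n₁ + 2)`
    obtain ⟨a₁, ha₁⟩ : ∃ a₁ : Fin 4 → ZMod (2 * S + 1),
        ∀ ν, a₁ ν = x ν - ((j * D - 1 : ℕ) : ZMod (2 * S + 1)) := ⟨_, fun ν => rfl⟩
    obtain ⟨n₁, hn₁⟩ : ∃ n₁ : ℕ, n₁ = w + 2 * (j * D - 1) := ⟨_, rfl⟩
    obtain ⟨a₂, ha₂⟩ : ∃ a₂ : Fin 4 → ZMod (2 * S + 1), ∀ ν, a₂ ν = a₁ ν - 1 :=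
      ⟨fun ν => a₁ ν - 1, fun ν => rfl⟩
    have hw₁ : w + 2 * (j * D) ≤ 2 * S := by omega
    have hIH := ih a₁ n₁ ha₁ hn₁ hw₁
    have e1 : ∀ ν, a₂ ν = x ν - ((j * D : ℕ) : ZMod (2 * S + 1)) := by
      intro ν; rw [ha₂ ν, ha₁ ν, Nat.cast_sub hjD]; push_cast; ring
    have e2 : n₁ + 2 = w + 2 * (j * D) := by omega
    have e3 : ∀ ν, a₂ ν - ((D - 1 : ℕ) : ZMod (2 * S + 1)) = a ν := by
      intro ν
      rw [ha ν, ha₂ ν, ha₁ ν, Nat.cast_sub hjD, Nat.cast_sub hD, Nat.cast_sub hjD1]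
      push_cast; ring
    have e4 : n₁ + 2 + 2 * (D - 1) = n := by omega
    have e5 : ∀ ν, a ν = a₁ ν - ((D : ℕ) : ZMod (2 * S + 1)) := by
      intro ν; rw [ha ν, ha₁ ν, Nat.cast_sub hjD, Nat.cast_sub hjD1]; push_cast; ring
    have e6 : n = n₁ + 2 * D := by omega
    -- the Markov version `Gj` of `μ[F | ext_{jD}]`, reading only `box(a₂, n₁ + 2)`
    have hn₁lt : n₁ + 2 < 2 * S + 1 := by omega
    have hFd₁ : DependsOn F {ℓ : Edge 4 (2 * S + 1) | ∀ ν, (ℓ.1 ν - a₂ ν).val < n₁ + 2} :=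
      hFd.mono (box_subset_enlarge x w (j * D) a₂ (n₁ + 2) e1 e2)
    obtain ⟨Gj, hGm, hGb, hGd, hGae⟩ :=
      exists_box_condExp_version r β S a₁ a₂ ha₂ n₁ hn₁lt hFm hFb hFd₁
    have hGae' : Gj =ᵐ[μ] μ[F|cylinderEvents (X := fun _ : Edge 4 (2 * S + 1) => G)
        {ℓ : Edge 4 (2 * S + 1) | ∀ ν, (ℓ.1 ν - a₁ ν).val < n₁}ᶜ] := hGae
    -- one step applied to `Gj` on `box(a₂, n₁ + 2)`; its margin-`D` exterior box is `box(a, n)`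
    have hv : n₁ + 2 + 2 * D ≤ 2 * S := by omega
    have hstep := one_step a₂ (n₁ + 2) hv Gj hGm M hGb hGd
    rw [box_congr e3 e4] at hstep
    -- `∫ Gj = ∫ F`
    have hGint : ∫ V, Gj V ∂μ = ∫ V, F V ∂μ :=
      (integral_congr_ae hGae').trans (integral_condExp cylinderEvents_le_pi)
    rw [hGint] at hstep
    -- tower property along the nested exteriors (`box(a₁, n₁) ⊆ box(a, n)`)
    have htower : μ[Gj|cylinderEvents (X := fun _ : Edge 4 (2 * S + 1) => G)
        {ℓ : Edge 4 (2 * S + 1) | ∀ ν, (ℓ.1 ν - a ν).val < n}ᶜ] =ᵐ[μ]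
        μ[F|cylinderEvents (X := fun _ : Edge 4 (2 * S + 1) => G)
          {ℓ : Edge 4 (2 * S + 1) | ∀ ν, (ℓ.1 ν - a ν).val < n}ᶜ] := by
      refine (condExp_congr_ae hGae').trans
        (condExp_condExp_of_le (cylinderEvents_mono ?_) cylinderEvents_le_pi)
      exact Set.compl_subset_compl.2 (box_subset_enlarge a₁ n₁ D a n e5 e6)
    have hL : (fun U => (μ[Gj|cylinderEvents (X := fun _ : Edge 4 (2 * S + 1) => G)
        {ℓ : Edge 4 (2 * S + 1) | ∀ ν, (ℓ.1 ν - a ν).val < n}ᶜ]) U - ∫ V, F V ∂μ) =ᵐ[μ]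
        fun U => (μ[F|cylinderEvents (X := fun _ : Edge 4 (2 * S + 1) => G)
          {ℓ : Edge 4 (2 * S + 1) | ∀ ν, (ℓ.1 ν - a ν).val < n}ᶜ]) U - ∫ V, F V ∂μ :=
      htower.sub EventuallyEq.rfl
    have hR : (fun U => Gj U - ∫ V, F V ∂μ) =ᵐ[μ]
        fun U => (μ[F|cylinderEvents (X := fun _ : Edge 4 (2 * S + 1) => G)
          {ℓ : Edge 4 (2 * S + 1) | ∀ ν, (ℓ.1 ν - a₁ ν).val < n₁}ᶜ]) U - ∫ V, F V ∂μ :=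
      hGae'.sub EventuallyEq.rfl
    rw [integral_sq_congr_ae hL, integral_sq_congr_ae hR] at hstep
    calc _ ≤ _ := hstep
      _ ≤ (1 - 1 / K) * ((1 - 1 / K) ^ j * ∫ U, (F U - ∫ V, F V ∂μ) ^ 2 ∂μ) :=
          mul_le_mul_of_nonneg_left hIH hq0
      _ = (1 - 1 / K) ^ (j + 1) * ∫ U, (F U - ∫ V, F V ∂μ) ^ 2 ∂μ := by ring

end Wilson

/-- **Stub S2 (`BoxToDecay`, registered explicit form, the torus Wilson state abstracted as `μ`
with `μ = wilsonMeasure r.ρ β`): the box inequality at margin `D` with constant `K` implies the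
geometric decay `(1 - 1/K)^j` of `∫ (μ[F | exterior at margin jD] - ∫ F)²` for bounded box
observables `F`.** Case `j = 0`: contraction; `j ≥ 1`: `decay_of_boxInequality`. -/
theorem stub_boxToDecay : ∀ (G : Type) [Group G] [TopologicalSpace G] [IsTopologicalGroup G] [CompactSpace G] [MeasurableSpace G] [BorelSpace G] (r : LatticeRep G) (β : ℝ) (S D : ℕ) (K : ℝ) (μ : Measure (GaugeConfig 4 (2 * S + 1) G)), μ = (wilsonMeasure r.ρ β : Measure (GaugeConfig 4 (2 * S + 1) G)) → 1 ≤ D → 1 ≤ K → (∀ (x : Fin 4 → ZMod (2 * S + 1)) (w : ℕ), w + 2 * D ≤ 2 * S → ∀ F : GaugeConfig 4 (2 * S + 1) G → ℝ, Measurable F → (∃ M : ℝ, ∀ U, |F U| ≤ M) → DependsOn F {ℓ : Edge 4 (2 * S + 1) | ∀ ν, (ℓ.1 ν - x ν).val < w} → ∫ U, (F U - ∫ V, F V ∂μ) ^ 2 ∂μ ≤ K * ∫ U, (F U - (μ[F|cylinderEvents {ℓ : Edge 4 (2 * S + 1) | ∀ ν, (ℓ.1 ν - (x ν - ((D - 1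 : ℕ) : ZMod (2 * S + 1)))).val < w + 2 * (D - 1)}ᶜ]) U) ^ 2 ∂μ) → ∀ (x : Fin 4 → ZMod (2 * S + 1)) (w j : ℕ), w + 2 * (j * D) ≤ 2 * S → ∀ F : GaugeConfig 4 (2 * S + 1) G → ℝ, Measurable F → (∃ M : ℝ, ∀ U, |F U| ≤ M) → DependsOn F {ℓ : Edge 4 (2 * S + 1) | ∀ ν, (ℓ.1 ν - x ν).val < w} → ∫ U, ((μ[F|cylinderEvents {ℓ : Edge 4 (2 * S + 1) | ∀ ν, (ℓ.1 ν - (x ν - ((j * D - 1 : ℕ) : ZMod (2 * S + 1)))).val < w + 2 * (j * D - 1)}ᶜ]) U - ∫ V, F V ∂μ) ^ 2 ∂μ ≤ (1 - 1 / K) ^ j * ∫ U, (F U - ∫ V, F V ∂μ) ^ 2 ∂μ := by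
  intro G _ _ _ _ _ _ r β S D K μ hμ hD hK hbox x w j hw F hFm hFb hFd
  subst hμ
  obtain ⟨M, hM⟩ := hFb
  rcases Nat.eq_zero_or_pos j with rfl | hj
  · haveI : IsProbabilityMeasure
        (wilsonMeasure (d := 4) (L := 2 * S + 1) r.ρ β : Measure (GaugeConfig 4 (2 * S + 1) G)) :=
      isProbabilityMeasure_wilsonMeasure (d := 4) (L := 2 * S + 1) r.ρ r.continuous β
    rw [pow_zero, one_mul]
    exact integral_condExp_sub_const_sq_le cylinderEvents_le_pi hFm.aestronglyMeasurable
      (ae_of_all _ hM) _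
  · exact decay_of_boxInequality r β S D K hD hK hbox x w hFm hM hFd j hj _ _ (fun ν => rfl) rfl hw

end Summit.QuantumFields.YangMills.Theorems.LatticeGapInUVUnitsC.NestedShell

end
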